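import Mathlib
import Summits.AtomisticToContinuum.HydrodynamicLimit.Theorems.JaynesSqueezeEntropicWeakStrongHSGammaA
import HarnessLib

/-!
# `EntropicWeakStrongHS` (stmt-AtomisticToContinuum-13461), calculus III: the integrated
# bookkeeping identity `Γ ≡ 0` of a classical hard-sphere Euler solution

For a classical solution `U = (ρ, ρu, E)` on `[0, T) × 𝕋³` under the low-density equation of
state, its entropy variables `λ` and every `0 ≤ s ≤ t < T`:
`∫ h(U(s)) - ∫ h(U(0)) = ∫ λ(s)·U(s) - ∫ λ(0)·U(0) - ∫₀ˢ ∫ (∂ₜλ·U + Σᵢ ∂ᵢλ·fᵢ(U))`,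
i.e. entropy conservation combined with the weak form of the conservation laws tested against
the solution's own entropy variables. Proof: `λ·U - h(U) = ρZ(ρσ³)` pointwise, the space integral
of `ρZ(ρσ³)` has one-sided time derivative `∫ ∂ₜλ·U` (differentiation under the integral,
`∂ₜ(ρZ) = ∂ₜλ·U`), `∫ Σᵢ ∂ᵢλ·fᵢ(U) = ∫ Σᵢ ∂ᵢ(ρZuᵢ) = 0` on the torus, and the fundamental
theorem of calculus on `[0, s]`.
-/

noncomputable section

open Set Filter MeasureTheory Function
open scoped Topology ContDiff

namespace Summit.AtomisticToContinuum.HydrodynamicLimit.Theorems.EntropicWeakStrong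

open Literature.MathematicalPhysics.KineticTheory Literature.Analysis.FunctionSpaces

section Solution

variable {σ T η₀ : ℝ} {F : ℝ → ℝ} {ρ θ : ℝ → T3 → ℝ} {u : ℝ → T3 → V3}

/-- **The bookkeeping identity `Γ ≡ 0` of a classical solution** (see the module docstring), in
the form consumed by the abstract Dafermos shell. The fields `Ucl` (conservative variables) and
`lam` (entropy variables) and the objects `θo, h, flux, pair` of the route statement enter as
parameters with their defining equations. -/
theorem bookkeeping_identity (hE : IsHardSphereEulerSolution σ T ρ u θ) (hσ : 0 < σ)
    (hFa : AnalyticOnNhd ℝ F (Ioo (-η₀) η₀)) (hF : EqOn hsExcessFreeEnergy F (Ico 0 η₀))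
    (hpack : ∀ t ∈ Ico 0 T, ∀ x, ρ t x * σ ^ 3 < η₀)
    (θo : (ℝ × V3 × ℝ) → ℝ)
    (hθo : θo = fun U => 2 / 3 * (U.2.2 / U.1 - ‖U.2.1‖ ^ 2 / (2 * U.1 ^ 2)))
    (h : (ℝ × V3 × ℝ) → ℝ)
    (hh : h = fun U => -(U.1 * (3 / 2 * Real.log (θo U) - Real.log U.1 -
      hsExcessFreeEnergy (U.1 * σ ^ 3))))
    (flux : Fin 3 → (ℝ × V3 × ℝ) → (ℝ × V3 × ℝ))
    (hflux : flux = fun i U => (U.2.1 i, (U.2.1 i / U.1) • U.2.1 +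
      hsPressure σ U.1 (θo U) • EuclideanSpace.single i (1 : ℝ),
      (U.2.2 + hsPressure σ U.1 (θo U)) * U.2.1 i / U.1))
    (pair : (ℝ × V3 × ℝ) → (ℝ × V3 × ℝ) → ℝ)
    (hpair : pair = fun L U => L.1 * U.1 + (∑ j, L.2.1 j * U.2.1 j) + L.2.2 * U.2.2)
    (Ucl : ℝ → T3 → (ℝ × V3 × ℝ))
    (hUcl : Ucl = fun s y => (ρ s y, ρ s y • u s y, totalEnergyDensity (ρ s y) (u s y) (θ s y)))
    (lam : ℝ → T3 → (ℝ × V3 × ℝ))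
    (hlam : lam = fun s y => ((-(3 / 2 * Real.log (θ s y) - Real.log (ρ s y) -
        hsExcessFreeEnergy (ρ s y * σ ^ 3)) + 5 / 2 - ‖u s y‖ ^ 2 / (2 * θ s y) +
        ρ s y * σ ^ 3 * deriv hsExcessFreeEnergy (ρ s y * σ ^ 3) : ℝ),
        (θ s y)⁻¹ • u s y, -(θ s y)⁻¹))
    {t : ℝ} (ht : t ∈ Ico 0 T) :
    ∀ s ∈ Icc 0 t, (∫ x, h (Ucl s x)) - (∫ x, h (Ucl 0 x)) =
      (∫ x, pair (lam s x) (Ucl s x)) - (∫ x, pair (lam 0 x) (Ucl 0 x)) -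
        ∫ τ in (0:ℝ)..s, ∫ x, (pair (Torus.timeDerivWithin (Ico 0 T) lam τ x) (Ucl τ x) +
          ∑ i, pair (Torus.partialDeriv i (lam τ) x) (flux i (Ucl τ x))) := by
  intro s hs
  have hU : UniqueDiffOn ℝ (Ico (0 : ℝ) T) := uniqueDiffOn_Ico 0 T
  have hsub : Icc 0 s ⊆ Ico 0 T := fun τ hτ => ⟨hτ.1, lt_of_le_of_lt (hτ.2.trans hs.2) ht.2⟩
  have h0T : (0 : ℝ) ∈ Ico 0 T := ⟨le_rfl, ht.1.trans_lt ht.2⟩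
  have hsT : s ∈ Ico 0 T := hsub (right_mem_Icc.2 hs.1)
  -- the auxiliary field `ρ Z(ρσ³)` and its space integral
  set Bf : ℝ → T3 → ℝ := fun s y => ρ s y * (1 + ρ s y * σ ^ 3 * deriv F (ρ s y * σ ^ 3)) with hBf
  have hBsm : Torus.IsSmoothSpaceTimeOn (Ico 0 T) Bf := isSmoothSpaceTimeOn_rhoZ hE hσ hFa hpack
  have hBder : ∀ τ ∈ Ico 0 T, HasDerivWithinAt (fun τ => ∫ y, Bf τ y)
      (∫ y, Torus.timeDerivWithin (Ico 0 T) Bf τ y) (Ico 0 T) τ :=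
    fun τ hτ => hBsm.hasDerivWithinAt_integral (convex_Ico 0 T) hτ
  -- smoothness of the slices we integrate
  have hUsm : Torus.IsSmoothSpaceTimeOn (Ico 0 T) Ucl := by
    rw [hUcl]; exact isSmoothSpaceTimeOn_consVar hE
  have hhUsm : Torus.IsSmoothSpaceTimeOn (Ico 0 T) (fun s y => h (Ucl s y)) := by
    rw [hUcl]; exact isSmoothSpaceTimeOn_entropy_consVar hE hσ hFa hF hpack θo hθo h hh
  -- (1) `λ·U = h(U) + ρZ` pointwise, hence for the integrals
  have hpt1 : ∀ τ ∈ Ico 0 T, ∀ x, pair (lam τ x) (Ucl τ x) = h (Ucl τ x) + Bf τ x := by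
    intro τ hτ x
    have key := pair_entropyVar_sub_entropy_eq hE hσ hF hpack θo hθo h hh pair hpair hτ x
    rw [hlam, hUcl]
    simp only [hBf]
    linarith
  have hint1 : ∀ τ ∈ Ico 0 T, (∫ x, pair (lam τ x) (Ucl τ x)) = (∫ x, h (Ucl τ x)) + ∫ x, Bf τ x := by
    intro τ hτ
    rw [integral_congr_ae (Eventually.of_forall fun x => hpt1 τ hτ x)]
    exact integral_add (hhUsm.isSmooth_slice hτ).integrable (hBsm.isSmooth_slice hτ).integrable
  -- (2) the flux pairing integrates to the time derivative of `∫ ρZ`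
  have hXU : ∀ τ ∈ Ico 0 T, (∫ x, (pair (Torus.timeDerivWithin (Ico 0 T) lam τ x) (Ucl τ x) +
      ∑ i, pair (Torus.partialDeriv i (lam τ) x) (flux i (Ucl τ x)))) =
      ∫ y, Torus.timeDerivWithin (Ico 0 T) Bf τ y := by
    intro τ hτ
    have hpt : ∀ x, pair (Torus.timeDerivWithin (Ico 0 T) lam τ x) (Ucl τ x) +
        ∑ i, pair (Torus.partialDeriv i (lam τ) x) (flux i (Ucl τ x)) =
        Torus.timeDerivWithin (Ico 0 T) Bf τ x +
          ∑ i, Torus.partialDeriv i (fun y => Bf τ y * u τ y i) x := by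
      intro x
      rw [hlam, hUcl]
      rw [pair_timeDeriv_entropyVar_consVar_eq hE hσ hFa hF hpack pair hpair hτ x]
      congr 1
      refine Finset.sum_congr rfl fun i _ => ?_
      rw [pair_partialDeriv_entropyVar_flux_eq hE hσ hFa hF hpack θo hθo flux hflux pair hpair hτ x i]
    rw [integral_congr_ae (Eventually.of_forall hpt)]
    have hBu : ∀ i, Torus.IsSmooth (fun y => Bf τ y * u τ y i) := fun i =>
      (hBsm.isSmooth_slice hτ).mul ((hE.smooth_velocity.isSmooth_slice hτ).apply i)
    have hi1 : Integrable (Torus.timeDerivWithin (Ico 0 T) Bf τ) volume :=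
      (hBsm.isSmooth_timeDerivWithin hU hτ).integrable
    have hi2 : Integrable (fun x => ∑ i, Torus.partialDeriv i (fun y => Bf τ y * u τ y i) x) volume :=
      integrable_finsetSum _ fun i _ => ((hBu i).partialDeriv i).integrable
    rw [integral_add hi1 hi2, integral_finsetSum _ fun i _ => ((hBu i).partialDeriv i).integrable]
    rw [Finset.sum_eq_zero fun i _ => Torus.integral_partialDeriv_eq_zero_holds (hBu i) i, add_zero]
  -- (3) fundamental theorem of calculus on `[0, s]`
  have hFTC : ∫ τ in (0:ℝ)..s, (∫ y, Torus.timeDerivWithin (Ico 0 T) Bf τ y) =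
      (∫ y, Bf s y) - ∫ y, Bf 0 y := by
    refine intervalIntegral.integral_eq_sub_of_hasDeriv_right_of_le (E := ℝ) hs.1
      (f := fun τ => ∫ y, Bf τ y) (f' := fun τ => ∫ y, Torus.timeDerivWithin (Ico 0 T) Bf τ y) ?_ ?_ ?_
    · intro τ hτ
      exact ((hBder τ (hsub hτ)).continuousWithinAt).mono hsub
    · intro τ hτ
      have hτT : τ ∈ Ico 0 T := hsub (Ioo_subset_Icc_self hτ)
      refine (hBder τ hτT).mono_of_mem_nhdsWithin ?_
      exact mem_of_superset (Ioo_mem_nhdsGT hτT.2) fun r hr => ⟨hτT.1.trans hr.1.le, hr.2⟩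
    · refine ContinuousOn.intervalIntegrable ?_
      rw [uIcc_of_le hs.1]
      exact ((hBsm.timeDerivWithin hU).continuousOn_integral (convex_Ico 0 T)).mono hsub
  have hIXU : ∫ τ in (0:ℝ)..s, (∫ x, (pair (Torus.timeDerivWithin (Ico 0 T) lam τ x) (Ucl τ x) +
      ∑ i, pair (Torus.partialDeriv i (lam τ) x) (flux i (Ucl τ x)))) =
      (∫ y, Bf s y) - ∫ y, Bf 0 y := by
    rw [← hFTC]
    refine intervalIntegral.integral_congr fun τ hτ => ?_
    rw [uIcc_of_le hs.1] at hτ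
    exact hXU τ (hsub hτ)
  -- (4) assemble
  rw [hIXU, hint1 s hsT, hint1 0 h0T]
  ring

end Solution

end Summit.AtomisticToContinuum.HydrodynamicLimit.Theorems.EntropicWeakStrong

end
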